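import Literature.NumberTheory.GelbartRogawski1991.LocalSplittingCMGaloisTransportRigidity
import Literature.NumberTheory.GelbartRogawski1991.LocalMpGaloisRescaling
import HarnessLib

/-!
# The Galois twist followed by the dilation carries the CM splitting of `T₀^𝔻` to the CM splitting of `(t•T₀)^𝔻`

Topic `NumberTheory/GelbartRogawski1991`; namespace `Literature.NumberTheory.GelbartRogawski1991.UnitaryDualPair.LocalSplitting`.
KERNEL ONLY: one theorem; no definition, no named fact, no `sorry`.

Cell `hodgecm-mathlib`, row III-11a (`LocalTypeGaloisTwist`), the DOUBLED-LEVEL INSTANTIATION of the transport-agnostic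
rigidity theorem `comp_localSplittingDatumCM_eq_of_galoisTransport` (`LocalSplittingCMGaloisTransportRigidity`, P3b) with
the concrete transport of P3a ∘ P4: `Ψ = e_{D_s} ∘ galTwist σ : S̃p_ψ(𝕎^𝔻_v, T₀^𝔻) →* S̃p_ψ(𝕎^𝔻_v, (t•T₀)^𝔻)`
(`exists_galTwist_rescale`, `LocalMpGaloisRescaling`; `σ ∘ ψ_v = ψ_v(κ ·)`, `κ = t s²`), whose two exported properties —
projection = identity on `𝕎 ≃ₗ 𝕎`, `ω′(Ψ x)(D_s(σ∘f)) = D_s(σ ∘ ω(x) f)` — are exactly the hypotheses (Ψ1)/(Ψ2) of the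
rigidity theorem (`(D_s(σ∘f))(0) = σ(f(0))`, `leviEquivSB_smulOfUnit_schwartzGalConj_apply_zero`; surjectivity
`surjective_leviEquivSB_smulOfUnit_schwartzGalConj`), while (Ψ3) «`Ψ ∘ s^𝔻_{T₀,μ}` lies over `ι^𝔻 ∘ scaleInl`» is
`proj_localSplitting` + `coe_iota_scaleInl` (`ι^{tT}(scaleInl k) = ι^T(k)` on `𝕎`).  CONCLUSION
(`exists_galTwist_rescale_comp_localSplittingDatumCM_eq`): there is such a `Ψ` with

  `Ψ ∘ s^𝔻_{T₀, μ} = s^𝔻_{t•T₀, μ} ∘ scaleInl`.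

So «the `σ`-twist of the `μ`-normalised doubled Weil representation of `T₀` IS the `μ`-normalised doubled Weil
representation of `t•T₀`» ([Liu2021] proof of Thm. 4.18 (3), l. 2272, «Since `Gal(ℂ/M_μ)` stabilizes `μ`»; [Kudla1994]
Thm. 3.1) — the input of the undoubling/`congrW` step and of the III-11a assembler `localTypeGaloisTwist_holds`.

## References
* [Liu2021] Y. Liu, Camb. J. Math. 9 (2021), proof of Thm. 4.18 (3), l. 2272.  [Kudla1994] S. Kudla, Israel J. Math. 87
  (1994), §3 Thm. 3.1.  [MoeglinVignerasWaldspurger1987] Chap. 2 II.1.  [GelbartRogawski1991] §3.1 p. 454, Remark p. 457.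
-/

set_option autoImplicit false

noncomputable section

open NumberField IsDedekindDomain Matrix
open Literature.RepresentationTheory.HeisenbergGroup
open Literature.NumberTheory.Automorphic Literature.NumberTheory.Automorphic.UnitaryGroup
open Literature.RepresentationTheory.HarrisKudlaSweet1996
open Literature.NumberTheory.GaloisRepresentations
open Literature.NumberTheory.Automorphic.IdeleClassGroup (toHeckeCharacter)

namespace Literature.NumberTheory.GelbartRogawski1991.UnitaryDualPair.LocalSplitting

variable (L : Type) [Field L] [NumberField L] [IsCMField L] (v : HeightOneSpectrum (𝓞 (maximalRealSubfield L)))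
  [MeasurableSpace (v.adicCompletion (maximalRealSubfield L))] [BorelSpace (v.adicCompletion (maximalRealSubfield L))]
  (μ : MeasureTheory.Measure (v.adicCompletion (maximalRealSubfield L))) [μ.IsAddHaarMeasure]
  (n : ℕ) {T₀ T₀' : Matrix (Fin n) (Fin n) (maximalRealSubfield L)} {JD JD' : Matrix (Fin (n + n)) (Fin (n + n)) L}

set_option maxHeartbeats 3200000 in
/-- **THE GALOIS TWIST FOLLOWED BY THE DILATION CARRIES `s^𝔻_{T₀,μ}` TO `s^𝔻_{t•T₀,μ}`.**  For a CM field `L`,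
`F = L⁺`, a diagonal `T₀` (`hT₀diag`), `T₀′ = t • T₀` (`t ∈ F^×`), a unitary idèle class character `μ = ψ` with
splitting Hecke character `χ = μ`, `σ ∈ Aut(ℂ)` fixing `M_μ` (`hσ`), `κ ∈ F_v` with `σ ∘ ψ_v = ψ_v(κ·)` (`hκ`,
`AdelicAdditiveCharacterGaloisTwist`) and `s ∈ F_v^×` with `s²t = κ` (`hκs`, `TotallyPositivePrescribedSquareClass`): the
transport `Ψ = e_{D_s} ∘ galTwist σ` of `exists_galTwist_rescale` (projection = identity on `𝕎^𝔻_v`;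
`ω′(Ψ x)(D_s(σ ∘ f)) = D_s(σ ∘ ω(x) f)`) satisfies `Ψ ∘ s^𝔻_{T₀,μ} = s^𝔻_{t•T₀,μ} ∘ scaleInl` — by
`comp_localSplittingDatumCM_eq_of_galoisTransport` (Kudla rigidity + «`Gal(ℂ/M_μ)` stabilizes `μ`»).
[cite: Liu2021, proof of Thm. 4.18 (3), l. 2272] [cite: Kudla1994, Thm 3.1] [cite: MoeglinVignerasWaldspurger1987, Chap. 2 II.1 (B)] -/
theorem exists_galTwist_rescale_comp_localSplittingDatumCM_eq (hn : 0 < n)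
    (d : Fin n → maximalRealSubfield L) (hT₀diag : T₀ = Matrix.diagonal d)
    (hT₀ : T₀.IsSymm) (hT₀det : IsUnit T₀.det) (t : (maximalRealSubfield L)ˣ)
    (hTT₀ : T₀' = (t : maximalRealSubfield L) • T₀) (hT₀' : T₀'.IsSymm) (hT₀'det : IsUnit T₀'.det)
    (hJD : JD = (gramD (maximalRealSubfield L) n T₀).map (algebraMap (maximalRealSubfield L) L))
    (hJD' : JD' = (gramD (maximalRealSubfield L) n T₀').map (algebraMap (maximalRealSubfield L) L))
    (ψ : IdeleClassGroup L →ₜ* Circle) (hχ : IsSplittingChar L 1 (toHeckeCharacter L ψ))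
    (σ : ℂ ≃+* ℂ) (hσ : ∀ z ∈ Liu2021.fieldOfValues L ψ, σ z = z)
    (κ : v.adicCompletion (maximalRealSubfield L))
    (hκ : ∀ r : v.adicCompletion (maximalRealSubfield L),
      (σ : ℂ →+* ℂ) ((adeleAddCharAt (maximalRealSubfield L) v r : Circle) : ℂ) =
        ((adeleAddCharAt (maximalRealSubfield L) v (κ * r) : Circle) : ℂ))
    (s : (v.adicCompletion (maximalRealSubfield L))ˣ)
    (hκs : (s : v.adicCompletion (maximalRealSubfield L)) * s *
      algebraMap (maximalRealSubfield L) (v.adicCompletion (maximalRealSubfield L)) (t : maximalRealSubfield L) = κ) :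
    ∃ Ψ : LocalMp (maximalRealSubfield L) (n + n) (gramD (maximalRealSubfield L) n T₀) v →*
        LocalMp (maximalRealSubfield L) (n + n) (gramD (maximalRealSubfield L) n T₀') v,
      (∀ x, ((MpPsi.proj _ (Ψ x) : LocalSp (maximalRealSubfield L) (n + n) (gramD (maximalRealSubfield L) n T₀') v) :
          ((Fin (n + n) → v.adicCompletion (maximalRealSubfield L)) × (Fin (n + n) → v.adicCompletion (maximalRealSubfield L))) ≃ₗ[v.adicCompletion (maximalRealSubfield L)]
            ((Fin (n + n) → v.adicCompletion (maximalRealSubfield L)) × (Fin (n + n) → v.adicCompletion (maximalRealSubfield L)))) =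
        (MpPsi.proj _ x : LocalSp (maximalRealSubfield L) (n + n) (gramD (maximalRealSubfield L) n T₀) v)) ∧
      (∀ x (f : SchwartzBruhat (Fin (n + n) → v.adicCompletion (maximalRealSubfield L))),
        MpPsi.toRep (localSchrodinger (maximalRealSubfield L) (n + n) (gramD (maximalRealSubfield L) n T₀') v) (Ψ x)
            (leviEquivSB (LinearEquiv.smulOfUnit s) (continuous_const_smul (s : v.adicCompletion (maximalRealSubfield L)))
              (continuous_const_smul ((s⁻¹ : (v.adicCompletion (maximalRealSubfield L))ˣ) : v.adicCompletion (maximalRealSubfield L)))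
              (schwartzGalConj (σ : ℂ →+* ℂ) f)) =
          leviEquivSB (LinearEquiv.smulOfUnit s) (continuous_const_smul (s : v.adicCompletion (maximalRealSubfield L)))
            (continuous_const_smul ((s⁻¹ : (v.adicCompletion (maximalRealSubfield L))ˣ) : v.adicCompletion (maximalRealSubfield L)))
            (schwartzGalConj (σ : ℂ →+* ℂ)
              (MpPsi.toRep (localSchrodinger (maximalRealSubfield L) (n + n) (gramD (maximalRealSubfield L) n T₀) v) x f))) ∧
      Ψ.comp (localSplittingDatumCM L v μ n hT₀ hT₀det hJD (toHeckeCharacter L ψ) hχ).localSplitting =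
        (localSplittingDatumCM L v μ n hT₀' hT₀'det hJD' (toHeckeCharacter L ψ) hχ).localSplitting.comp
          (scaleInl (maximalRealSubfield L) L (IsCMField.complexConj L) (n + n) (gramD (maximalRealSubfield L) n T₀)
            (gramD (maximalRealSubfield L) n T₀') t (gramD_of_eq_smul (maximalRealSubfield L) t hTT₀) hJD hJD' v) := by
  -- `σ⁻¹ : ℂ →+* ℂ` and the two inverse identities
  have hσσ' : ∀ z, (σ : ℂ →+* ℂ) ((σ.symm : ℂ →+* ℂ) z) = z := fun z => σ.apply_symm_apply z
  have hσ'σ : ∀ z, (σ.symm : ℂ →+* ℂ) ((σ : ℂ →+* ℂ) z) = z := fun z => σ.symm_apply_apply z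
  -- the transport `Ψ = e_{D_s} ∘ galTwist σ` of P3a ∘ P4
  obtain ⟨Ψ, hΨproj, hΨop⟩ := exists_galTwist_rescale (F := maximalRealSubfield L) (N := n + n)
    (T := gramD (maximalRealSubfield L) n T₀) (T' := gramD (maximalRealSubfield L) n T₀') (t := t)
    (hTT' := gramD_of_eq_smul (maximalRealSubfield L) t hTT₀) (v := v) (τ := (σ : ℂ →+* ℂ)) (τ' := (σ.symm : ℂ →+* ℂ))
    (hττ' := hσσ') (hτ'τ := hσ'σ) (κ := κ) (hκ := hκ) (s := s) (hκs := hκs)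
  refine ⟨Ψ, hΨproj, hΨop, ?_⟩
  -- `T₀′` is diagonal
  have hT₀'diag : T₀' = Matrix.diagonal ((t : maximalRealSubfield L) • d) := by
    rw [hTT₀, hT₀diag, Matrix.diagonal_smul]
  refine comp_localSplittingDatumCM_eq_of_galoisTransport L v μ n hn t ((t : maximalRealSubfield L) • d) hT₀'diag
    hT₀ hT₀det hT₀' hT₀'det (gramD_of_eq_smul (maximalRealSubfield L) t hTT₀) hJD hJD' ψ hχ σ hσ Ψ hΨproj
    (fun f => leviEquivSB (LinearEquiv.smulOfUnit s) (continuous_const_smul (s : v.adicCompletion (maximalRealSubfield L)))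
      (continuous_const_smul ((s⁻¹ : (v.adicCompletion (maximalRealSubfield L))ˣ) : v.adicCompletion (maximalRealSubfield L)))
      (schwartzGalConj (σ : ℂ →+* ℂ) f))
    (surjective_leviEquivSB_smulOfUnit_schwartzGalConj (F := maximalRealSubfield L) (N := n + n) (v := v)
      (τ := (σ : ℂ →+* ℂ)) (τ' := (σ.symm : ℂ →+* ℂ)) (hττ' := hσσ') (s := s))
    (fun f => leviEquivSB_smulOfUnit_schwartzGalConj_apply_zero (F := maximalRealSubfield L) (N := n + n) (v := v)
      (τ := (σ : ℂ →+* ℂ)) (s := s) f)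
    (fun x f => ?_) (fun k => ?_)
  · -- `(ω′(Ψ x)(D_s(σ∘f)))(0) = σ((ω(x) f)(0))`
    rw [hΨop x f]
    exact leviEquivSB_smulOfUnit_schwartzGalConj_apply_zero (F := maximalRealSubfield L) (N := n + n) (v := v)
      (τ := (σ : ℂ →+* ℂ)) (s := s) _
  · -- `Ψ ∘ s^𝔻_{T₀,μ}` lies over `ι^𝔻_{T₀′} ∘ scaleInl`
    apply Subtype.ext
    rw [hΨproj, LocalSplittingDatum.proj_localSplitting,
      coe_iota_scaleInl (maximalRealSubfield L) L (IsCMField.complexConj L) (n + n) (complexConj_imagUnit L)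
        (imagUnit_ne_zero L) (imagUnit_mul_self L) (gramD (maximalRealSubfield L) n T₀) (gramD (maximalRealSubfield L) n T₀')
        (gramD_isSymm (maximalRealSubfield L) n hT₀) (gramD_isSymm (maximalRealSubfield L) n hT₀') t
        (gramD_of_eq_smul (maximalRealSubfield L) t hTT₀) hJD hJD' v]

/-! ## §2 Gram bookkeeping for the LINE instantiation of the transport

For the level-`N` instantiation of `exists_galTwist_rescale` / `exists_section_galTwist_rescale` at two members `a₀`, `a₁` of the
family of [Liu2021, Def. 4.11] (`T := gram e₁ T_V (a₀)`, `T' := gram e₁ T_V (a₁)`, `e₁ = Equiv.prodUnique`), the binder `hTT'` is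
the identity (γ) below with `t := a₁ a₀⁻¹`; the second form prints the scalar as `a₁ · a₀⁻¹ ∈ F`, the currency of the face binder
`s · s · (a₁ a₀⁻¹) = κ`. -/

section GramLine

open Literature.NumberTheory.Automorphic.Liu2021.Def411WeilCarriers (TW)
open scoped Kronecker

variable {F : Type} [Field F] {N : ℕ}

/-- **(γ) the Gram matrices of `V ⊗ ⟨a₁⟩` and `V ⊗ ⟨a₀⟩` differ by the unit `t = a₁a₀⁻¹`:**
`gram e₁ T_V (a₁) = (a₁ a₀⁻¹) • gram e₁ T_V (a₀)` at `e₁ = Equiv.prodUnique` (both sides are `aᵢ • T_V`, `gram_prodUnique_TW`).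
[cite: GelbartRogawski1991, §3.1 p. 454] -/
theorem gram_prodUnique_TW_eq_units_smul (TV : Matrix (Fin N) (Fin N) F) (a₀ a₁ : Fˣ) :
    gram F (Equiv.prodUnique (Fin N) (Fin 1)) TV (TW F a₁) =
      ((a₁ * a₀⁻¹ : Fˣ) : F) • gram F (Equiv.prodUnique (Fin N) (Fin 1)) TV (TW F a₀) := by
  rw [gram_prodUnique_TW, gram_prodUnique_TW, smul_smul, ← Units.val_mul, inv_mul_cancel_right]

/-- (γ) with the scalar printed as `a₁ · a₀⁻¹ ∈ F`: `gram e₁ T_V (a₁) = (a₁ · a₀⁻¹) • gram e₁ T_V (a₀)`.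
[cite: GelbartRogawski1991, §3.1 p. 454] -/
theorem gram_prodUnique_TW_eq_mul_inv_smul (TV : Matrix (Fin N) (Fin N) F) (a₀ a₁ : Fˣ) :
    gram F (Equiv.prodUnique (Fin N) (Fin 1)) TV (TW F a₁) =
      ((a₁ : F) * (a₀ : F)⁻¹) • gram F (Equiv.prodUnique (Fin N) (Fin 1)) TV (TW F a₀) := by
  rw [gram_prodUnique_TW_eq_units_smul TV a₀ a₁, Units.val_mul, Units.val_inv_eq_inv_val]

/-- coercion bookkeeping for the rescaling binder: `s · s · ι(↑(a₁a₀⁻¹)) = s · s · ι(a₁ · a₀⁻¹)` for any ring map `ι : F → K`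
(turns the face binder `s·s·ι(a₁·a₀⁻¹) = κ` into the `hκs` of `exists_galTwist_rescale` at `t := a₁a₀⁻¹`, and back).
[cite: GelbartRogawski1991, §3.1 p. 454] -/
theorem mul_mul_map_units_mul_inv {K : Type} [CommRing K] (ι : F →+* K) (s : K) (a₀ a₁ : Fˣ) :
    s * s * ι ((a₁ * a₀⁻¹ : Fˣ) : F) = s * s * ι ((a₁ : F) * (a₀ : F)⁻¹) := by
  rw [Units.val_mul, Units.val_inv_eq_inv_val]

/-- `gram e T_V (a · b) = a • gram e T_V (b)` for ANY relabelling `e : Fin N × Fin 1 ≃ Fin n` (entries `T_{ij} · (ab) = a · (T_{ij} · b)`).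
[cite: GelbartRogawski1991, §3.1 p. 454] -/
theorem gram_TW_mul {n : ℕ} (e : Fin N × Fin 1 ≃ Fin n) (TV : Matrix (Fin N) (Fin N) F) (a b : Fˣ) :
    gram F e TV (TW F (a * b)) = (a : F) • gram F e TV (TW F b) := by
  have hTW : ∀ (x : Fˣ) (i' j' : Fin 1), TW F x i' j' = (x : F) := fun x i' j' => by
    rw [Subsingleton.elim i' 0, Subsingleton.elim j' 0]; rfl
  refine Matrix.ext fun i j => ?_
  change (TV ⊗ₖ TW F (a * b)) (e.symm i) (e.symm j) = (a : F) * (TV ⊗ₖ TW F b) (e.symm i) (e.symm j)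
  rw [Matrix.kroneckerMap_apply, Matrix.kroneckerMap_apply, hTW, hTW, Units.val_mul]
  ring

/-- **(γ) for ANY relabelling `e`**: `gram e T_V (a₁) = (a₁a₀⁻¹) • gram e T_V (a₀)` (the `hTT₀` of
`exists_galTwist_rescale_comp_localSplittingDatumCM_eq` at `T₀ := gram e T_V (a₀)`, `T₀' := gram e T_V (a₁)`, `t := a₁a₀⁻¹`).
[cite: GelbartRogawski1991, §3.1 p. 454] -/
theorem gram_TW_eq_units_smul {n : ℕ} (e : Fin N × Fin 1 ≃ Fin n) (TV : Matrix (Fin N) (Fin N) F) (a₀ a₁ : Fˣ) :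
    gram F e TV (TW F a₁) = ((a₁ * a₀⁻¹ : Fˣ) : F) • gram F e TV (TW F a₀) := by
  rw [← gram_TW_mul e TV (a₁ * a₀⁻¹) a₀, inv_mul_cancel_right]

/-- **the Gram matrix of `diag(d) ⊗ ⟨a⟩` is diagonal** for any relabelling `e`: `gram e diag(d) (a) = diag(i ↦ d_{(e⁻¹ i)₁} · a)` (the
`hT₀diag` of `exists_galTwist_rescale_comp_localSplittingDatumCM_eq` for the members of the family of [Liu2021, Def. 4.11]).
[cite: GelbartRogawski1991, §3.1 p. 454] -/
theorem gram_diagonal_TW {n : ℕ} (e : Fin N × Fin 1 ≃ Fin n) (d : Fin N → F) (a : Fˣ) :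
    gram F e (Matrix.diagonal d) (TW F a) = Matrix.diagonal fun i => d (e.symm i).1 * (a : F) := by
  have hTW : ∀ (i' j' : Fin 1), TW F a i' j' = (a : F) := fun i' j' => by
    rw [Subsingleton.elim i' 0, Subsingleton.elim j' 0]; rfl
  refine Matrix.ext fun i j => ?_
  change ((Matrix.diagonal d) ⊗ₖ TW F a) (e.symm i) (e.symm j) = Matrix.diagonal (fun i => d (e.symm i).1 * (a : F)) i j
  rw [Matrix.kroneckerMap_apply, hTW]
  by_cases h : i = j
  · subst h
    rw [Matrix.diagonal_apply_eq, Matrix.diagonal_apply_eq]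
  · have h1 : (e.symm i).1 ≠ (e.symm j).1 := fun h1 =>
      h (e.symm.injective (Prod.ext h1 (Subsingleton.elim _ _)))
    rw [Matrix.diagonal_apply_ne _ h1, Matrix.diagonal_apply_ne _ h, zero_mul]

/-- the CM instance: `gram e (realDiagonal d) (a) = diag(i ↦ d_{(e⁻¹ i)₁} · a)` with real entries (the `hT₀diag` for the carriers
`V = diag(d_V)`, `W = ⟨a⟩` of [Liu2021, Def. 4.11] in the CM lane). [cite: GelbartRogawski1991, §3.1 p. 454] -/
theorem gram_realDiagonal_TW (L : Type) [Field L] [NumberField L] [IsCMField L] {n : ℕ} (e : Fin N × Fin 1 ≃ Fin n)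
    (d : Fin N → L) (hd : ∀ i, IsCMField.complexConj L (d i) = d i) (a : (maximalRealSubfield L)ˣ) :
    gram (maximalRealSubfield L) e (realDiagonal L d hd) (TW (maximalRealSubfield L) a) =
      Matrix.diagonal fun i => realDiagonal L d hd (e.symm i).1 (e.symm i).1 * (a : maximalRealSubfield L) := by
  rw [realDiagonal, gram_diagonal_TW]
  simp only [Matrix.diagonal_apply_eq]

end GramLine

end Literature.NumberTheory.GelbartRogawski1991.UnitaryDualPair.LocalSplitting

end
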